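import Summits.Ventures.QEC.CircuitDistance.PortFibreLeaf
import HarnessLib

/-!
# P3-PORT (D2b): a KERNEL-CHEAP well-formedness check `Leaf.wf₂` for large leaves (cell `qec`, experiment CDX, seat qec-cdx-type-1)

`Leaf.wf` tests every CNF row against EVERY admissible row (`|rows| × |admissible|` permutation tests — hours in the kernel for the
777-coordinate budget-1 leaves of `[[144,12,12]]`).  `Leaf.wf₂` tabulates the detector rows once and tests each CNF row only
against the detector rows of the detectors of its first coordinate (then against the `k − 1` link rows); `Leaf.wf_of_wf₂`
recovers `L.wf = true`, so all leaf lemmas apply unchanged.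
-/

namespace Summit.Ventures.QEC.CircuitDistance.Fibre

/-- The detector rows, tabulated. -/
def Leaf.detTable (L : Leaf) : List (ℕ × List ℕ) := L.detectors.map fun d => (d, L.detRow d)

/-- The group-link rows `C₀ ++ C_j`, `j ≥ 1`. -/
def Leaf.linkRows (L : Leaf) : List (List ℕ) :=
  ((List.range L.k).filter fun j => j ≠ 0).map fun j => L.group 0 ++ L.group j

/-- FAST ROW ADMISSIBILITY: a detector row of a detector of the row's first coordinate, or a link row (up to permutation). -/
def Leaf.rowOK (L : Leaf) (tbl : List (ℕ × List ℕ)) (links : List (List ℕ)) (r : List ℕ) : Bool :=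
  (match r with
    | [] => false
    | c :: _ => (L.coordsOf c).any fun d =>
        match tbl.find? (fun da => da.1 == d) with
        | none => false
        | some da => decide (r.Perm da.2)) ||
  links.any fun a => decide (r.Perm a)

/-- KERNEL-CHEAP WELL-FORMEDNESS (same meaning as `Leaf.wf`). -/
def Leaf.wf₂ (L : Leaf) : Bool :=
  let tbl := L.detTable
  let links := L.linkRows
  decide (0 < L.k) &&
  ((L.groups.flatten ++ L.nulls).all fun c => decide (c < L.n)) &&
  decide (L.groups.flatten ++ L.nulls).Nodup &&
  (L.rows.all fun r => L.rowOK tbl links r) &&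
  decide (L.us = [L.group 0]) &&
  decide (L.k ≤ L.w)

/-- A row accepted by `rowOK` is admissible up to permutation. -/
theorem Leaf.rowOK_sound (L : Leaf) (r : List ℕ) (h : L.rowOK L.detTable L.linkRows r = true) :
    ∃ a ∈ L.admissible, r.Perm a := by
  unfold Leaf.rowOK at h
  rw [Bool.or_eq_true] at h
  rcases h with h | h
  · cases r with
    | nil => exact absurd h Bool.false_ne_true
    | cons c cs =>
      simp only [List.any_eq_true] at h
      obtain ⟨d, -, hd⟩ := h
      rcases hf : L.detTable.find? (fun da => da.1 == d) with _ | da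
      · rw [hf] at hd; exact absurd hd Bool.false_ne_true
      · rw [hf, decide_eq_true_eq] at hd
        have hmem := List.mem_of_find?_eq_some hf
        unfold Leaf.detTable at hmem
        obtain ⟨d', hd', rfl⟩ := List.mem_map.1 hmem
        refine ⟨L.detRow d', ?_, hd⟩
        unfold Leaf.admissible
        exact List.mem_append_left _ (List.mem_map.2 ⟨d', hd', rfl⟩)
  · rw [List.any_eq_true] at h
    obtain ⟨a, ha, hp⟩ := h
    rw [decide_eq_true_eq] at hp
    refine ⟨a, ?_, hp⟩
    unfold Leaf.admissible
    exact List.mem_append_right _ ha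

/-- **`wf₂` implies `wf`.** -/
theorem Leaf.wf_of_wf₂ (L : Leaf) (h : L.wf₂ = true) : L.wf = true := by
  unfold Leaf.wf₂ at h
  unfold Leaf.wf
  simp only [Bool.and_eq_true, List.all_eq_true, decide_eq_true_eq] at h ⊢
  obtain ⟨⟨⟨⟨⟨h0, hb⟩, hnd⟩, hrows⟩, hus⟩, hk⟩ := h
  refine ⟨⟨⟨⟨⟨h0, hb⟩, hnd⟩, fun r hr => ?_⟩, hus⟩, hk⟩
  rw [List.any_eq_true]
  obtain ⟨a, ha, hp⟩ := L.rowOK_sound r (hrows r hr)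
  exact ⟨a, ha, decide_eq_true hp⟩

end Summit.Ventures.QEC.CircuitDistance.Fibre
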